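import Summits.BirchSwinnertonDyer.BirchSwinnertonDyer.Theorems.SylvesterTwoHeegnerIndexYinPointToricDescent
import HarnessLib

/-!
# Route `SylvesterTwoHeegnerIndex` (rung K7t): `B(L)[2] = 0` for every model `B ≅ E_p` over any field `L` of
# `ℚ`-degree prime to `3` — the «no point of order `2`» clause of the toric binder, by a degree count

HONEST FRAMING (cell b2b-bsdres, seat x1b GEN 53 = O12 class lead; file `--supports
stmt-BirchSwinnertonDyer-19802 --as helper`; C′ and THEOREM C stay OPEN; nothing here is a mechanism, a
definition or a named fact). bsd-cm-two g9's binder `YinToricDecomposition` (stub (T) of the skeletons of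
record S-19802/toric and VARIANT G, planner D148) asks its provider, for the quadratic `L/K` (source:
`L = K(i)`, `[L : ℚ] = 4`), for the clause `∀ Q ∈ B(L), 2•Q = 0 → Q = 0` («`ℚ(E_p[2]) = ℚ(ω, ∛(4p))` has
degree `6 ∤ 4`»). This file proves that clause ONCE for every field `L` of finite `ℚ`-degree NOT divisible
by `3` and every model `B ≅ E_p` (`p` an odd prime), so a discharge of (T) gets it by `exact`:

* `pow_three_ne_of_padicValRat_eq_one` — `r³ ≠ m` in `ℚ` if `v_ℓ(m) = 1`; hence `r³ ≠ 2p²` (`v₂ = 1`);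
* `forall_pow_three_ne_cast_of_not_three_dvd_finrank` — a rational non-cube `a` is not a cube in `L` when
  `3 ∤ [L : ℚ]`: the minimal polynomial of a cube root divides `X³ − a`, its degree divides `[L : ℚ]`, so it
  is `1` or `2`, and either way `X³ − a` acquires a RATIONAL linear factor, i.e. a rational cube root;
* **`eq_zero_of_two_nsmul_eq_zero_of_not_three_dvd_finrank`** — `3 ∤ [L : ℚ]`, `p` odd prime, `C • B = E_p`
  ⟹ `B(L)[2] = 0` (x1b [161] §5 `eq_zero_of_two_nsmul_eq_zero_of_variableChange`: a `2`-torsion point needs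
  `∛(2p²) ∈ L`); corollaries for `[L : ℚ] = 4` (two's `L = K(i)`) and `[L : ℚ] = 2` (`K` itself).

NO definition, NO named fact, NO sorry; axioms standard; closes no item; nothing booked; no label moves.
References: MEMO-bsd-cm-two v2.10 §52.3 (B4); `…YinToricDefs` (p503032) docstring of `YinToricDecomposition`;
Silverman AEC III.2.3 (2-torsion = roots of the cubic).
-/

set_option autoImplicit false
-- the Summit-side namespace `Summit.BirchSwinnertonDyer.BirchSwinnertonDyer.…` (summit = problem) is mandated by D-0017
set_option linter.dupNamespace false

noncomputable section

open scoped Classical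

open Polynomial WeierstrassCurve WeierstrassCurve.Affine WeierstrassCurve.Affine.Point
open Summit.BirchSwinnertonDyer.BirchSwinnertonDyer.Theorems.SylvesterTwoThmCTwist
  Literature.NumberTheory.EllipticCurves Literature.NumberTheory.EllipticCurves.HuShuYin2019

namespace Summit.BirchSwinnertonDyer.BirchSwinnertonDyer.Theorems.SylvesterTwoYinToricDescent

/-! ## §1 Rational non-cubes -/

/-- `r³ ≠ m` in `ℚ` when some prime `ℓ` divides `m` exactly once (`3·v_ℓ(r) = 1` is impossible;
`r = 0` gives `m = 0`, `v_ℓ(0) = 0 ≠ 1`). [folklore] -/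
theorem pow_three_ne_of_padicValRat_eq_one (ℓ : ℕ) [Fact ℓ.Prime] {r m : ℚ} (h1 : padicValRat ℓ m = 1) :
    r ^ 3 ≠ m := by
  intro h
  have hv := congrArg (padicValRat ℓ) h
  rw [padicValRat.pow, h1] at hv
  omega

/-- `2p²` is not a rational cube for an odd prime `p` (`v₂(2p²) = 1`; the valuation computation is x1b [158]
`padicValRat_two_mul_pow`, restated here to keep the import light). [folklore] -/
theorem forall_pow_three_ne_two_mul_sq {p : ℕ} (hp : p.Prime) (hp2 : p ≠ 2) (r : ℚ) :
    r ^ 3 ≠ 2 * (p : ℚ) ^ 2 := by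
  refine pow_three_ne_of_padicValRat_eq_one 2 ?_
  have hp0 : (p : ℚ) ≠ 0 := by exact_mod_cast hp.ne_zero
  have h22 : padicValRat 2 (2 : ℚ) = 1 := by simpa using padicValRat.self (p := 2) one_lt_two
  have h : padicValNat 2 p = 0 := padicValNat.eq_zero_of_not_dvd fun hd =>
    hp2 ((Nat.prime_dvd_prime_iff_eq Nat.prime_two hp).mp hd).symm
  rw [padicValRat.mul two_ne_zero (pow_ne_zero 2 hp0), padicValRat.pow, h22, padicValRat.of_nat, h]
  simp

/-! ## §2 A rational non-cube stays a non-cube in any field of `ℚ`-degree prime to `3` -/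

section Degree

variable {L : Type*} [Field L] [CharZero L] [FiniteDimensional ℚ L]

/-- **Degree count.** If `a ∈ ℚ` is not a rational cube and `3 ∤ [L : ℚ]`, then `a` is not a cube in `L`:
for `z³ = a` the minimal polynomial `m` of `z` over `ℚ` divides `X³ − a` and `deg m ∣ [L : ℚ]`
(Mathlib `minpoly.degree_dvd`), so `deg m ∈ {1, 2}`; then `m` (if linear) or its cofactor in `X³ − a` (if
`m` is quadratic) is a rational LINEAR factor of `X³ − a`, whose root is a rational cube root of `a`.
[folklore] -/
theorem forall_pow_three_ne_cast_of_not_three_dvd_finrank (h3 : ¬ 3 ∣ Module.finrank ℚ L) {a : ℚ}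
    (ha : ∀ r : ℚ, r ^ 3 ≠ a) (z : L) : z ^ 3 ≠ (a : L) := by
  intro hz
  have hint : IsIntegral ℚ z := IsIntegral.of_finite ℚ z
  have hne : (X ^ 3 - C a : ℚ[X]) ≠ 0 := X_pow_sub_C_ne_zero (by norm_num) a
  have hdeg3 : (X ^ 3 - C a : ℚ[X]).natDegree = 3 := natDegree_X_pow_sub_C
  have hroot : aeval z (X ^ 3 - C a : ℚ[X]) = 0 := by
    rw [map_sub, map_pow, aeval_X, aeval_C, eq_ratCast, hz, sub_self]
  obtain ⟨q, hq⟩ := minpoly.dvd ℚ z hroot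
  have hm0 : minpoly ℚ z ≠ 0 := minpoly.ne_zero hint
  have hq0 : q ≠ 0 := right_ne_zero_of_mul (hq ▸ hne)
  have hsum : (minpoly ℚ z).natDegree + q.natDegree = 3 := by
    rw [← hdeg3, hq, natDegree_mul hm0 hq0]
  have hpos : 0 < (minpoly ℚ z).natDegree := minpoly.natDegree_pos hint
  have hdvdfin : (minpoly ℚ z).natDegree ∣ Module.finrank ℚ L := minpoly.degree_dvd hint
  -- a rational linear factor `f` of `X³ − a`
  obtain ⟨f, hf1, g, hfg⟩ : ∃ f : ℚ[X], f.natDegree = 1 ∧ f ∣ (X ^ 3 - C a : ℚ[X]) := by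
    by_cases h1 : (minpoly ℚ z).natDegree = 1
    · exact ⟨minpoly ℚ z, h1, q, hq⟩
    · by_cases h2 : (minpoly ℚ z).natDegree = 2
      · exact ⟨q, by omega, minpoly ℚ z, by rw [hq, mul_comm]⟩
      · exfalso
        have h3' : (minpoly ℚ z).natDegree = 3 := by omega
        exact h3 (h3' ▸ hdvdfin)
  -- its root is a rational cube root of `a`
  have hf0 : f ≠ 0 := by rintro rfl; simp at hf1
  have hfdeg : f.degree = 1 := by rw [degree_eq_natDegree hf0]; exact_mod_cast hf1
  obtain ⟨r, hr⟩ := exists_root_of_degree_eq_one hfdeg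
  have hra : (X ^ 3 - C a : ℚ[X]).eval r = 0 := by rw [hfg, eval_mul, hr.eq_zero, zero_mul]
  rw [eval_sub, eval_pow, eval_X, eval_C, sub_eq_zero] at hra
  exact ha r hra

end Degree

/-! ## §3 `B(L)[2] = 0` for every model of `E_p` over such `L` -/

section NoTwoTorsion

variable {L : Type*} [Field L] [CharZero L] [FiniteDimensional ℚ L]

/-- **`B(L)[2] = 0` when `3 ∤ [L : ℚ]`.** `p` an odd prime, `C • B = E_p` over `ℚ`, `L` a field of finite
`ℚ`-degree not divisible by `3`: every `T ∈ B(L)` with `2•T = 0` is `𝒪` — a point of order `2` would give a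
cube root of `2p²` in `L` (x1b [161] §5), but `2p²` is not a rational cube (`v₂ = 1`) and `3 ∤ [L : ℚ]` (§2).
This is the «no point of order `2`» clause of bsd-cm-two's `YinToricDecomposition` for its quadratic `L/K`
(`[K(i) : ℚ] = 4`), proved once for all such `L`. [cite: SilvermanAEC2009, III.2.3] -/
theorem eq_zero_of_two_nsmul_eq_zero_of_not_three_dvd_finrank (h3 : ¬ 3 ∣ Module.finrank ℚ L)
    {p : ℕ} (hp : p.Prime) (hp2 : p ≠ 2) (B : WeierstrassCurve ℚ) (C : VariableChange ℚ)
    (hC : C • B = cubeSumCurve (p : ℚ)) (T : (B.baseChange L).toAffine.Point) (hT : (2 : ℕ) • T = 0) :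
    T = 0 := by
  refine eq_zero_of_two_nsmul_eq_zero_of_variableChange (p : ℚ) (fun z hz => ?_) B C hC T hT
  refine forall_pow_three_ne_cast_of_not_three_dvd_finrank h3 (forall_pow_three_ne_two_mul_sq hp hp2) z ?_
  rw [hz]
  push_cast
  ring

/-- **The case `[L : ℚ] = 4`** — two's `L = K(i)` (`K = ℚ(ω)`): `B(L)[2] = 0` for every model `B ≅ E_p`,
`p` an odd prime. [cite: SilvermanAEC2009, III.2.3] -/
theorem eq_zero_of_two_nsmul_eq_zero_of_finrank_eq_four (h4 : Module.finrank ℚ L = 4)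
    {p : ℕ} (hp : p.Prime) (hp2 : p ≠ 2) (B : WeierstrassCurve ℚ) (C : VariableChange ℚ)
    (hC : C • B = cubeSumCurve (p : ℚ)) (T : (B.baseChange L).toAffine.Point) (hT : (2 : ℕ) • T = 0) :
    T = 0 :=
  eq_zero_of_two_nsmul_eq_zero_of_not_three_dvd_finrank (by rw [h4]; decide) hp hp2 B C hC T hT

/-- **The case `[L : ℚ] = 2`** — the quadratic field `K` itself (e.g. `K = ℚ(ω)`): `B(K)[2] = 0` for every
model `B ≅ E_p`, `p` an odd prime. [cite: SilvermanAEC2009, III.2.3] -/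
theorem eq_zero_of_two_nsmul_eq_zero_of_finrank_eq_two (h2 : Module.finrank ℚ L = 2)
    {p : ℕ} (hp : p.Prime) (hp2 : p ≠ 2) (B : WeierstrassCurve ℚ) (C : VariableChange ℚ)
    (hC : C • B = cubeSumCurve (p : ℚ)) (T : (B.baseChange L).toAffine.Point) (hT : (2 : ℕ) • T = 0) :
    T = 0 :=
  eq_zero_of_two_nsmul_eq_zero_of_not_three_dvd_finrank (by rw [h2]; decide) hp hp2 B C hC T hT

end NoTwoTorsion

end Summit.BirchSwinnertonDyer.BirchSwinnertonDyer.Theorems.SylvesterTwoYinToricDescent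

end
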